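import Summits.AnomalousDissipation.AnomalousDissipation.Theorems.MarginalStabilityChainChainRealisationStubSobolevLadderTools
import Literature.Analysis.FunctionSpaces.TorusClassicalNSGluing
import Literature.Analysis.FunctionSpaces.TorusLinearisedFormTruncation
import HarnessLib

/-!
# Stub `stub_sobolevLadder` of the line `SketchIdeator2` (card `separatrix-flux-pinning`)
# (crux `MarginalStabilityChain.ChainRealisation`, stmt-AnomalousDissipation-14249)

Sorry-free discharge of the registered stub `stub_sobolevLadder` (P3) of the lead's skeleton: the
**Sobolev ladder**, i.e. the all-orders absorbing bounds of a forward classical Navier–Stokes orbit on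
`T³` at fixed viscosity `ν > 0` (C. Foias, O. Manley, R. Rosa, R. Temam, *Navier–Stokes Equations and
Turbulence*, CUP 2001, Ch. II App. A (A.61)–(A.66); P. Constantin, C. Foias, *Navier–Stokes Equations*,
Chicago 1988, Ch. 13).  Given the pure-derivative balances (stub P1, taken as a hypothesis), a forward
classical solution `u` on `[0, ∞) × T³` forced by a smooth steady `F`, with mean-zero slices,
`‖∇u(t)‖₂² ≤ M` (`t ≥ 0`), `‖Δu(t)‖₂² ≤ M₂` (`t ≥ 1`) and the sliding-window bound
`∫ₜ^{t+1} Σᵢ‖∂ᵢ³u‖² ≤ C` (`t ≥ 1`, stub P2) is bounded in every lattice Sobolev norm: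
`latNormSq m (u t) ≤ C_m` for all `m` and all `t ≥ 0`.

Paper proof.  Put `P_m(s) = Σᵢ ∫‖∂ᵢᵐu(s)‖²` and `y_m(s) = ∫‖u(s)‖² + P_m(s)`; then
`latNormSq m (u s) ≤ 4ᵐ y_m(s)` (`ladder_latNormSq_le`).  Summing the balances of orders `0` and `m`
over the three directions and estimating the commutator pairings by the tame estimate
`Torus.exists_abs_integral_inner_iterate_convect_le` (`m ≥ 3`), the force pairings by Young and the
dissipation from below by `P_{m+1}` gives, from the right at every `s ≥ 0`,
`y_m' ≤ −2ν P_{m+1} + (K_m (1 + y₃) + 1) y_m + H_m` (`ladder_deriv_ineq`, `ladder_rate_le`).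
Since `∫‖u‖² ≤ ‖∇u‖₂² ≤ M` (Poincaré, mean zero), the hypothesis P2 is a window bound
`∫ₜ^{t+1} y₃ ≤ M + C` (`t ≥ 1`).  Induction on `m ≥ 3`: a window bound `∫ₜ^{t+1} y_m ≤ A` (`t ≥ T`)
gives `y_m(t) ≤ B` for `t ≥ T + 1` by the uniform Gronwall lemma (landed `stub_uniformGronwall`, with
`∫ₜ^{t+1}(K_m(1 + y₃) + 1) ≤ K_m(1 + M + C) + 1`; `ladder_gronwall_step`), and integrating the
level-`m` inequality over `[t, t+1]` then gives `2ν ∫ₜ^{t+1} P_{m+1} ≤ B + (K_m(1 + M + C) + 1)B + H_m`,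
a window bound at level `m + 1` (`ladder_window_step`).  Finally `y_m` is continuous on `[0, ∞)`
(`ladder_continuousOn_lev`), hence bounded on the compact `[0, T]`, and the levels `m < 3` follow from
`m = 3` by monotonicity of `latNormSq` in `m` (`Torus.latNormSq_mono`).
-/

set_option linter.dupNamespace false

noncomputable section

open MeasureTheory Set Filter Topology
open scoped InnerProductSpace
open Literature.Analysis.FunctionSpaces Literature.Analysis.FunctionSpaces.Torus
open Literature.Analysis.FluidPDE Literature.Analysis.FluidPDE.Torus

namespace Summit.AnomalousDissipation.AnomalousDissipation.Theorems.ChainRealisation.SeparatrixFluxPinning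

/-- Local notation: the torus `T³`. -/
local notation "𝕋³" => UnitAddTorus (Fin 3)
/-- Local notation: velocity values. -/
local notation "E³" => EuclideanSpace ℝ (Fin 3)
/-- Local notation (abbreviates the recurring level-`m` energy of the slice `u s`, kept syntactic so that
the helper lemmas of the Tools file apply verbatim): `LEV[u, m, s] = ∫‖u(s)‖² + Σᵢ ∫‖∂ᵢᵐu(s)‖²`. -/
local notation "LEV[" u ", " m ", " s "]" =>
  ((∫ x, ‖u s x‖ ^ 2) + ∑ i : Fin 3, ∫ x, ‖((Torus.partialDeriv i)^[m] (u s)) x‖ ^ 2)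
/-- Local notation (same purpose): the pure energy `PURE[u, m, s] = Σᵢ ∫‖∂ᵢᵐu(s)‖²` of the slice `u s`. -/
local notation "PURE[" u ", " m ", " s "]" =>
  (∑ i : Fin 3, ∫ x, ‖((Torus.partialDeriv i)^[m] (u s)) x‖ ^ 2)

/-! ## The differential inequality of the level energies along a forward solution -/

/-- **The level-`m` differential inequality along the flow.**  Let `u : [0, ∞) → (T³ → ℝ³)` have
smooth divergence-free slices and satisfy the pure balances (right derivatives at every `s ≥ 0`,
orders `0` and `m`, all directions) with viscosity `ν ≥ 0` and steady smooth force `F`.  Then for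
`m ≥ 3` there are `K, H ≥ 0` and a function `Y'` with `d⁺/ds y_m(u(s)) = Y'(s)` and
`Y'(s) ≤ −2ν P_{m+1}(u(s)) + (K(1 + y₃(u(s))) + 1) y_m(u(s)) + H` for all `s ≥ 0`
(`H = ∫‖F‖² + Σᵢ∫‖∂ᵢᵐF‖²`; sum of the balances and `ladder_rate_le`). -/
theorem ladder_deriv_ineq {ν : ℝ} {F : 𝕋³ → E³} {u : ℝ → 𝕋³ → E³} (hν : 0 ≤ ν) (hF : IsSmooth F)
    (hus : ∀ s : ℝ, 0 ≤ s → IsSmooth (u s)) (hdiv : ∀ s : ℝ, 0 ≤ s → IsDivFree (u s))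
    (hD : ∀ (i : Fin 3) (m : ℕ) (s : ℝ), 0 ≤ s →
      HasDerivWithinAt (fun r => 2⁻¹ * ∫ x, ‖((partialDeriv i)^[m] (u r)) x‖ ^ 2)
        (-ν * gradNormSq ((partialDeriv i)^[m] (u s)) -
            (∫ x, ⟪((partialDeriv i)^[m] (convect (u s) (u s))) x, ((partialDeriv i)^[m] (u s)) x⟫_ℝ) +
          ∫ x, ⟪((partialDeriv i)^[m] F) x, ((partialDeriv i)^[m] (u s)) x⟫_ℝ)
        (Ici s) s)
    {m : ℕ} (hm : 3 ≤ m) :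
    ∃ K : ℝ, 0 ≤ K ∧ ∃ H : ℝ, 0 ≤ H ∧ ∃ Y' : ℝ → ℝ,
      (∀ s : ℝ, 0 ≤ s → HasDerivWithinAt (fun r => LEV[u, m, r]) (Y' s) (Ici s) s) ∧
      ∀ s : ℝ, 0 ≤ s →
        Y' s ≤ -(2 * ν) * PURE[u, m + 1, s] + (K * (1 + LEV[u, 3, s]) + 1) * LEV[u, m, s] + H := by
  obtain ⟨K, hK0, hK⟩ := ladder_rate_le hm
  refine ⟨K, hK0, (∫ x, ‖F x‖ ^ 2) + ∑ i : Fin 3, ∫ x, ‖((partialDeriv i)^[m] F) x‖ ^ 2,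
    add_nonneg (integral_nonneg fun _ => sq_nonneg _)
      (Finset.sum_nonneg fun _ _ => integral_nonneg fun _ => sq_nonneg _),
    fun s => 2 * (-ν * gradNormSq (u s) - (∫ x, ⟪convect (u s) (u s) x, u s x⟫_ℝ) +
        ∫ x, ⟪F x, u s x⟫_ℝ) +
      2 * ∑ i : Fin 3, (-ν * gradNormSq ((partialDeriv i)^[m] (u s)) -
          (∫ x, ⟪((partialDeriv i)^[m] (convect (u s) (u s))) x, ((partialDeriv i)^[m] (u s)) x⟫_ℝ) +
        ∫ x, ⟪((partialDeriv i)^[m] F) x, ((partialDeriv i)^[m] (u s)) x⟫_ℝ),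
    fun s hs => ?_, fun s hs => hK ν (u s) F hν (hus s hs) hF (hdiv s hs)⟩
  have h2 : (2 : ℝ) ≠ 0 := two_ne_zero
  have hA0 : HasDerivWithinAt (fun r => ∫ x, ‖u r x‖ ^ 2)
      (2 * (-ν * gradNormSq (u s) - (∫ x, ⟪convect (u s) (u s) x, u s x⟫_ℝ) +
        ∫ x, ⟪F x, u s x⟫_ℝ)) (Ici s) s := by
    have := (hD 0 0 s hs).const_mul 2
    simpa only [Function.iterate_zero, id_eq, mul_inv_cancel_left₀ h2] using this
  have hAi : ∀ i : Fin 3, HasDerivWithinAt (fun r => ∫ x, ‖((partialDeriv i)^[m] (u r)) x‖ ^ 2)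
      (2 * (-ν * gradNormSq ((partialDeriv i)^[m] (u s)) -
          (∫ x, ⟪((partialDeriv i)^[m] (convect (u s) (u s))) x, ((partialDeriv i)^[m] (u s)) x⟫_ℝ) +
        ∫ x, ⟪((partialDeriv i)^[m] F) x, ((partialDeriv i)^[m] (u s)) x⟫_ℝ)) (Ici s) s := by
    intro i
    have := (hD i m s hs).const_mul 2
    simpa only [mul_inv_cancel_left₀ h2] using this
  have hsum := hA0.fun_add (HasDerivWithinAt.fun_sum fun i (_ : i ∈ Finset.univ) => hAi i)
  rw [← Finset.mul_sum] at hsum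
  exact hsum

/-! ## The stub -/

/-- **Stub `stub_sobolevLadder` (P3 of the line `SketchIdeator2`): the Sobolev ladder — all-orders
absorbing bounds of a forward Navier–Stokes orbit at fixed `ν > 0`.**  Given the pure balances P1 (as
a hypothesis), a forward classical solution on `[0, ∞) × T³` forced by a smooth steady `F`, with
mean-zero slices, `‖∇u‖₂² ≤ M` on `t ≥ 0`, `‖Δu‖₂² ≤ M₂` on `t ≥ 1` and the window bound
`∫ₜ^{t+1} Σᵢ‖∂ᵢ³u‖² ≤ C` (`t ≥ 1`) satisfies `latNormSq m (u t) ≤ C_m` for ALL `m` and ALL `t ≥ 0`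
(Foias–Manley–Rosa–Temam 2001, Ch. II (A.61)–(A.66); Constantin–Foias 1988, Ch. 13).
Proof: with `y_m(s) = ∫‖u(s)‖² + Σᵢ∫‖∂ᵢᵐu(s)‖²` (`latNormSq m ≤ 4ᵐ y_m`, `ladder_latNormSq_le`), the
balances and the tame commutator estimate give `y_m' ≤ −2ν P_{m+1} + (K_m(1 + y₃) + 1) y_m + H_m`
(`ladder_deriv_ineq`).  The window bound on `y₃` (hypothesis + Poincaré `∫‖u‖² ≤ ‖∇u‖₂² ≤ M`)
starts an induction on `m ≥ 3`: a window bound on `y_m` gives `sup_{t ≥ T} y_m < ∞` by the uniform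
Gronwall lemma (`ladder_gronwall_step`), which integrated over `[t, t+1]` gives a window bound on
`P_{m+1}`, hence on `y_{m+1}` (`ladder_window_step`).  On the compact `[0, T]` the continuous `y_m` is
bounded, and `m < 3` follows from `m = 3` by monotonicity of the lattice norms.  (The hypothesis
`‖Δu‖₂² ≤ M₂` of the registered signature enters only through the window bound it produced in stub P2;
it is not used again here.) -/
theorem stub_sobolevLadder :
    (∀ (a b ν : ℝ) (f u : ℝ → 𝕋³ → E³) (p : ℝ → 𝕋³ → ℝ),
      IsClassicalNSSolutionOn (Icc a b) ν f u p → a < b → (∀ t ∈ Icc a b, IsSmooth (f t)) →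
      ∀ (i : Fin 3) (m : ℕ) (t : ℝ), t ∈ Icc a b →
      HasDerivWithinAt (fun s => 2⁻¹ * ∫ x, ‖((partialDeriv i)^[m] (u s)) x‖ ^ 2)
        (-ν * gradNormSq ((partialDeriv i)^[m] (u t)) -
            (∫ x, ⟪((partialDeriv i)^[m] (convect (u t) (u t))) x, ((partialDeriv i)^[m] (u t)) x⟫_ℝ) +
          ∫ x, ⟪((partialDeriv i)^[m] (f t)) x, ((partialDeriv i)^[m] (u t)) x⟫_ℝ)
        (Icc a b) t) →
    ∀ (ν M M₂ : ℝ) (F : 𝕋³ → E³) (u : ℝ → 𝕋³ → E³) (p : ℝ → 𝕋³ → ℝ),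
      0 < ν → IsSmooth F → IsClassicalNSSolutionOn (Set.Ici 0) ν (fun _ => F) u p →
      (∀ t : ℝ, 0 ≤ t → HasZeroMean (u t)) →
      (∀ t : ℝ, 0 ≤ t → gradNormSq (u t) ≤ M) →
      (∀ t : ℝ, 1 ≤ t → ∫ x, ‖laplacian (u t) x‖ ^ 2 ≤ M₂) →
      (∃ C : ℝ, ∀ t : ℝ, 1 ≤ t →
        ∫ s in t..t + 1, (∑ i : Fin 3, ∫ x, ‖((partialDeriv i)^[3] (u s)) x‖ ^ 2) ≤ C) →
      ∀ m : ℕ, ∃ C : ℝ, ∀ t : ℝ, 0 ≤ t → latNormSq m (u t) ≤ C := by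
  intro hP1 ν M M₂ F u p hν hF h hzm hM _hM₂ hwin
  obtain ⟨Cw, hCw⟩ := hwin
  have hu : IsSmoothSpaceTimeOn (Ici (0 : ℝ)) u := h.smooth_velocity
  have hus : ∀ s : ℝ, 0 ≤ s → IsSmooth (u s) := fun s hs => hu.isSmooth_slice (mem_Ici.2 hs)
  have hdiv : ∀ s : ℝ, 0 ≤ s → IsDivFree (u s) := fun s hs => h.divFree s (mem_Ici.2 hs)
  -- right derivatives of the pure energies: P1 on `[s, s + 1]`
  have hD : ∀ (i : Fin 3) (m : ℕ) (s : ℝ), 0 ≤ s →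
      HasDerivWithinAt (fun r => 2⁻¹ * ∫ x, ‖((partialDeriv i)^[m] (u r)) x‖ ^ 2)
        (-ν * gradNormSq ((partialDeriv i)^[m] (u s)) -
            (∫ x, ⟪((partialDeriv i)^[m] (convect (u s) (u s))) x, ((partialDeriv i)^[m] (u s)) x⟫_ℝ) +
          ∫ x, ⟪((partialDeriv i)^[m] F) x, ((partialDeriv i)^[m] (u s)) x⟫_ℝ)
        (Ici s) s := by
    intro i m s hs
    have hs1 : s < s + 1 := lt_add_one s
    have h' : IsClassicalNSSolutionOn (Icc s (s + 1)) ν (fun _ => F) u p :=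
      h.mono (fun r hr => mem_Ici.2 (hs.trans hr.1)) (uniqueDiffOn_Icc hs1)
    exact (hP1 s (s + 1) ν (fun _ => F) u p h' hs1 (fun _ _ => hF) i m s ⟨le_rfl, hs1.le⟩
      ).mono_of_mem_nhdsWithin (Icc_mem_nhdsGE hs1)
  -- `∫‖u(s)‖² ≤ M` (`4π² ≥ 1` and Poincaré for mean-zero slices)
  have hL2 : ∀ s : ℝ, 0 ≤ s → ∫ x, ‖u s x‖ ^ 2 ≤ M := by
    intro s hs
    have hP := four_pi_sq_mul_integral_norm_sq_le_gradNormSq (hus s hs) (hzm s hs)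
    have h1 : (1 : ℝ) ≤ 4 * Real.pi ^ 2 := by nlinarith [Real.pi_gt_three]
    have h0 : 0 ≤ ∫ x, ‖u s x‖ ^ 2 := integral_nonneg fun _ => sq_nonneg _
    have h3 := hM s hs
    nlinarith
  -- continuity and signs of the energies
  have hYc : ∀ m : ℕ, ContinuousOn (fun s => LEV[u, m, s]) (Ici (0 : ℝ)) := fun m =>
    ladder_continuousOn_lev hu m
  have hPc : ∀ m : ℕ, ContinuousOn (fun s => PURE[u, m, s]) (Ici (0 : ℝ)) := fun m =>
    ladder_continuousOn_pure hu m
  have hEc : ContinuousOn (fun s => ∫ x, ‖u s x‖ ^ 2) (Ici (0 : ℝ)) := ladder_continuousOn_l2 hu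
  have hP0 : ∀ (m : ℕ) (s : ℝ), 0 ≤ PURE[u, m, s] := fun m s =>
    Finset.sum_nonneg fun _ _ => integral_nonneg fun _ => sq_nonneg _
  have hY0 : ∀ (m : ℕ) (s : ℝ), 0 ≤ LEV[u, m, s] := fun m s =>
    add_nonneg (integral_nonneg fun _ => sq_nonneg _) (hP0 m s)
  -- the window bound at level `3`
  have hW3 : ∀ t : ℝ, 1 ≤ t → ∫ s in t..t + 1, LEV[u, 3, s] ≤ M + Cw := by
    intro t ht
    have h1 := ladder_window_add_le (t₀ := 0) hEc (hPc 3) hL2 (zero_le_one.trans ht)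
    have h2 := hCw t ht
    linarith
  -- Gronwall step: a window bound at level `m ≥ 3` gives an eventual bound at level `m`
  have step1 : ∀ m : ℕ, 3 ≤ m →
      (∃ A T : ℝ, 1 ≤ T ∧ ∀ t : ℝ, T ≤ t → ∫ s in t..t + 1, LEV[u, m, s] ≤ A) →
      ∃ B T : ℝ, 1 ≤ T ∧ ∀ t : ℝ, T ≤ t → LEV[u, m, t] ≤ B := by
    rintro m hm ⟨A, T, hT, hA⟩
    obtain ⟨K, hK0, H, hH0, Y', hYd, hineq⟩ := ladder_deriv_ineq hν.le hF hus hdiv hD hm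
    have hT0 : (0 : ℝ) ≤ T := zero_le_one.trans hT
    have hsub : Ici T ⊆ Ici (0 : ℝ) := Ici_subset_Ici.2 hT0
    refine ⟨(A + H) * Real.exp (K * (1 + (M + Cw)) + 1), T + 1, by linarith, fun t ht => ?_⟩
    exact ladder_gronwall_step (Y := fun s => LEV[u, m, s]) (G := fun s => LEV[u, 3, s])
      (P := fun s => PURE[u, m + 1, s]) (t₀ := T) ((hYc m).mono hsub) ((hYc 3).mono hsub)
      (fun s hs => hYd s (hT0.trans hs)) (fun s hs => hineq s (hT0.trans hs))
      (fun s _ => hY0 m s) (fun s _ => hY0 3 s) (fun s _ => hP0 (m + 1) s) hν.le hK0 hH0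
      (fun r hr => hW3 r (hT.trans hr)) hA t ht
  -- window step: an eventual bound at level `m ≥ 3` gives a window bound at level `m + 1`
  have step2 : ∀ m : ℕ, 3 ≤ m →
      (∃ B T : ℝ, 1 ≤ T ∧ ∀ t : ℝ, T ≤ t → LEV[u, m, t] ≤ B) →
      ∃ A T : ℝ, 1 ≤ T ∧ ∀ t : ℝ, T ≤ t → ∫ s in t..t + 1, LEV[u, m + 1, s] ≤ A := by
    rintro m hm ⟨B, T, hT, hB⟩
    obtain ⟨K, hK0, H, _hH0, Y', hYd, hineq⟩ := ladder_deriv_ineq hν.le hF hus hdiv hD hm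
    have hT0 : (0 : ℝ) ≤ T := zero_le_one.trans hT
    have hsub : Ici T ⊆ Ici (0 : ℝ) := Ici_subset_Ici.2 hT0
    refine ⟨M + (B + (K * (1 + (M + Cw)) + 1) * B + H) / (2 * ν), T, hT, fun t ht => ?_⟩
    have h1 := ladder_window_step (Y := fun s => LEV[u, m, s]) (G := fun s => LEV[u, 3, s])
      (P := fun s => PURE[u, m + 1, s]) (t₀ := T) hν ((hYc m).mono hsub) ((hYc 3).mono hsub)
      ((hPc (m + 1)).mono hsub) (fun s hs => hYd s (hT0.trans hs))
      (fun s hs => hineq s (hT0.trans hs)) (fun s _ => hY0 m s) hB (fun s _ => hY0 3 s) hK0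
      (fun r hr => hW3 r (hT.trans hr)) t ht
    have h2 := ladder_window_add_le (t₀ := 0) hEc (hPc (m + 1)) hL2 (hT0.trans ht)
    linarith
  -- the induction on the level
  have hWin : ∀ m : ℕ, 3 ≤ m →
      ∃ A T : ℝ, 1 ≤ T ∧ ∀ t : ℝ, T ≤ t → ∫ s in t..t + 1, LEV[u, m, s] ≤ A := by
    intro m hm
    induction m, hm using Nat.le_induction with
    | base => exact ⟨M + Cw, 1, le_rfl, fun t ht => hW3 t ht⟩
    | succ m hm ih => exact step2 m hm (step1 m hm ih)
  -- all-time bounds for `m ≥ 3`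
  have hlat : ∀ m : ℕ, 3 ≤ m → ∃ C : ℝ, ∀ t : ℝ, 0 ≤ t → latNormSq m (u t) ≤ C := by
    intro m hm
    obtain ⟨B, T, _hT, hB⟩ := step1 m hm (hWin m hm)
    obtain ⟨B', hB'⟩ := isCompact_Icc.exists_bound_of_continuousOn
      ((hYc m).mono (Icc_subset_Ici_self : Icc 0 T ⊆ Ici 0))
    refine ⟨4 ^ m * max B B', fun t ht => ?_⟩
    have h1 := ladder_latNormSq_le (hus t ht) m
    have h2 : LEV[u, m, t] ≤ max B B' := by
      rcases le_or_gt T t with hTt | hTt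
      · exact (hB t hTt).trans (le_max_left _ _)
      · have h3 := hB' t ⟨ht, hTt.le⟩
        rw [Real.norm_eq_abs] at h3
        exact ((le_abs_self _).trans h3).trans (le_max_right _ _)
    exact h1.trans (mul_le_mul_of_nonneg_left h2 (by positivity))
  intro m
  obtain ⟨C, hC⟩ := hlat (max m 3) (le_max_right _ _)
  exact ⟨C, fun t ht => (latNormSq_mono (hus t ht) (le_max_left m 3)).trans (hC t ht)⟩

end Summit.AnomalousDissipation.AnomalousDissipation.Theorems.ChainRealisation.SeparatrixFluxPinning

end
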